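import Literature.AlgebraicGeometry.Frobenioids.PerfectionDivisorial
import Literature.AlgebraicGeometry.Frobenioids.ModelFrobenioid
import HarnessLib

/-!
# Frobenioids I, §0: roots in `(M^pf)^gp` — the identification "`B^pf → (Φ^gp)^pf = (Φ^pf)^gp`"

Mochizuki, *The geometry of Frobenioids I: the general theory*, Kyushu J. Math. **62** (2008)
293–400, §0 "Monoids" p. 11 (`M^pf`, `M^gp`, perfect monoids: "multiplication by every `n ∈ N_{≥1}` is
bijective") and Proposition 5.5 (iv) p. 104 ("the model Frobenioid associated to the data
`Φ^pf, B^pf, B^pf → (Φ^gp)^pf`" — where `(Φ^gp)^pf` is tacitly identified with `(Φ^pf)^gp`)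
[cite: MochizukiFrdI2008, §0 p.11].

Elementary algebra used by the `C^pf` row of Prop. 5.5 (iv) (sub-node P55-L08 of the cell's
SUBDAG-FrdI-Thm51iv-Prop55):

* a perfect commutative GROUP has `n`-th root isomorphisms `IsPerfect.rootEquiv` (inverse of `x ↦ x^n`);
* the Grothendieck group of a perfect commutative monoid is perfect (`IsPerfect.grothendieckGroup`), in
  particular `(M^pf)^gp` is (`isPerfect_gpPerfection`), with roots `gpRoot M n`;
* the natural map `M^gp → (M^pf)^gp` (`gpToPf M := MonGp.map (Perfection.of M)`, the component of
  `Functor.whiskerRight (toPerfectionFunctor Φ) MonGp.functor` in `IsPerfectedDiv`, `Prop55Sub.lean`), the formula `gpRoot n (gpToPf (of a)) = of (a^{1/n})`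
  (`gpRoot_gpToPf_of`), every element of `(M^pf)^gp` is such a root (`exists_eq_gpRoot_gpToPf`), and for
  CANCELLATIVE `M` the kernel criterion `gpToPf x = gpToPf y ↔ ∃ N, x^N = y^N` (`gpToPf_eq_iff`).
Nothing here is specific to abc.
-/

namespace Literature.AlgebraicGeometry.Frobenioids

open Function

universe u

/-! ### Roots in a perfect commutative group -/

namespace IsPerfect

variable {G : Type u} [CommGroup G]

/-- The `n`-th power map of a perfect commutative group as an isomorphism. [cite: MochizukiFrdI2008, §0 p.11] -/
noncomputable def powEquiv (h : IsPerfect G) (n : ℕ+) : G ≃* G :=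
  MulEquiv.ofBijective (powMonoidHom (n : ℕ) : G →* G) (h.bijective_pow n n.pos)

/-- `powEquiv n x = x ^ n`. [cite: MochizukiFrdI2008, §0 p.11] -/
@[simp] theorem powEquiv_apply (h : IsPerfect G) (n : ℕ+) (x : G) : h.powEquiv n x = x ^ (n : ℕ) := rfl

/-- The `n`-th ROOT isomorphism of a perfect commutative group (inverse of `x ↦ x^n`).
[cite: MochizukiFrdI2008, §0 p.11] -/
noncomputable def rootEquiv (h : IsPerfect G) (n : ℕ+) : G ≃* G := (h.powEquiv n).symm

/-- `(root_n x)^n = x`. [cite: MochizukiFrdI2008, §0 p.11] -/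
@[simp] theorem rootEquiv_pow (h : IsPerfect G) (n : ℕ+) (x : G) : (h.rootEquiv n x) ^ (n : ℕ) = x :=
  (h.powEquiv n).apply_symm_apply x

/-- `root_n (x^n) = x`. [cite: MochizukiFrdI2008, §0 p.11] -/
@[simp] theorem rootEquiv_apply_pow (h : IsPerfect G) (n : ℕ+) (x : G) : h.rootEquiv n (x ^ (n : ℕ)) = x :=
  (h.powEquiv n).symm_apply_apply x

/-- Characterisation of the root: `y = root_n x ↔ y^n = x`. [cite: MochizukiFrdI2008, §0 p.11] -/
theorem eq_rootEquiv_iff (h : IsPerfect G) (n : ℕ+) {x y : G} : y = h.rootEquiv n x ↔ y ^ (n : ℕ) = x := by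
  constructor
  · rintro rfl
    exact h.rootEquiv_pow n x
  · rintro rfl
    exact (h.rootEquiv_apply_pow n y).symm

/-- Roots of roots: `root_{n m} x = root_n (root_m x)`. [cite: MochizukiFrdI2008, §0 p.11] -/
theorem rootEquiv_mul (h : IsPerfect G) (n m : ℕ+) (x : G) :
    h.rootEquiv (n * m) x = h.rootEquiv n (h.rootEquiv m x) := by
  rw [eq_comm, eq_rootEquiv_iff, PNat.mul_coe, pow_mul, rootEquiv_pow, rootEquiv_pow]

/-- `root_1 = id`. [cite: MochizukiFrdI2008, §0 p.11] -/
@[simp] theorem rootEquiv_one (h : IsPerfect G) (x : G) : h.rootEquiv 1 x = x := by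
  rw [eq_comm, eq_rootEquiv_iff, PNat.one_coe, pow_one]

/-- A homomorphism between perfect groups commutes with roots. [cite: MochizukiFrdI2008, §0 p.11] -/
theorem map_rootEquiv {G' : Type u} [CommGroup G'] (h : IsPerfect G) (h' : IsPerfect G') (f : G →* G')
    (n : ℕ+) (x : G) : f (h.rootEquiv n x) = h'.rootEquiv n (f x) := by
  rw [eq_rootEquiv_iff, ← map_pow, rootEquiv_pow]

end IsPerfect

/-! ### The Grothendieck group of a perfect monoid is perfect -/

section Gp

variable {M : Type u} [CommMonoid M]

/-- Equality in `M^gp`: `of a = of b` iff `c a = c b` for some `c ∈ M` (localisation at `⊤`).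
[cite: MochizukiFrdI2008, §0 p.11] -/
theorem gpOf_eq_gpOf_iff {a b : M} :
    Algebra.GrothendieckGroup.of a = Algebra.GrothendieckGroup.of b ↔ ∃ c : M, c * a = c * b :=
  ((Localization.monoidOf (⊤ : Submonoid M)).eq_iff_exists).trans
    ⟨fun ⟨c, h⟩ => ⟨c, h⟩, fun ⟨c, h⟩ => ⟨⟨c, Submonoid.mem_top c⟩, h⟩⟩

/-- Every element of `M^gp` is a fraction `of a / of b`. [cite: MochizukiFrdI2008, §0 p.11] -/
theorem gp_exists_eq_div' (x : Algebra.GrothendieckGroup M) :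
    ∃ a b : M, x = Algebra.GrothendieckGroup.of a / Algebra.GrothendieckGroup.of b := by
  obtain ⟨⟨a, b⟩, h⟩ := (Localization.monoidOf (⊤ : Submonoid M)).surj x
  exact ⟨a, b, eq_div_iff_mul_eq'.mpr h⟩

/-- **The Grothendieck group of a perfect commutative monoid is perfect** ("multiplication by `n`" is
bijective: surjective on fractions of `n`-th powers, injective because `(of a / of b)^n = 1` forces
`c a^n = c b^n`, `c = c'^n`, hence `c' a = c' b`). [cite: MochizukiFrdI2008, §0 p.11] -/
theorem IsPerfect.grothendieckGroup (h : IsPerfect M) : IsPerfect (Algebra.GrothendieckGroup M) := by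
  refine ⟨fun n hn => ⟨?_, ?_⟩⟩
  · -- injective: it suffices that the kernel of `x ↦ x^n` is trivial
    intro x y hxy
    dsimp only at hxy
    rw [← div_eq_one, ← div_pow] at hxy
    rw [← div_eq_one]
    obtain ⟨a, b, hab⟩ := gp_exists_eq_div' (x / y)
    rw [hab, div_pow, ← map_pow, ← map_pow, div_eq_one, gpOf_eq_gpOf_iff] at hxy
    obtain ⟨c, hc⟩ := hxy
    obtain ⟨c', rfl⟩ := (h.bijective_pow n hn).2 c
    dsimp only at hc
    rw [← mul_pow, ← mul_pow] at hc
    have hc' := (h.bijective_pow n hn).1 hc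
    rw [hab, div_eq_one, gpOf_eq_gpOf_iff]
    exact ⟨c', hc'⟩
  · intro y
    obtain ⟨a, b, rfl⟩ := gp_exists_eq_div' y
    obtain ⟨a', rfl⟩ := (h.bijective_pow n hn).2 a
    obtain ⟨b', rfl⟩ := (h.bijective_pow n hn).2 b
    exact ⟨Algebra.GrothendieckGroup.of a' / Algebra.GrothendieckGroup.of b', by
      dsimp only; rw [div_pow, map_pow, map_pow]⟩

variable (M) in
/-- `(M^pf)^gp` is perfect. [cite: MochizukiFrdI2008, §0 p.11] -/
theorem isPerfect_gpPerfection : IsPerfect (Algebra.GrothendieckGroup (Perfection M)) :=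
  (isPerfect_perfection (M := M)).grothendieckGroup

variable (M) in
/-- The `n`-th root isomorphism of `(M^pf)^gp`. [cite: MochizukiFrdI2008, §0 p.11] -/
noncomputable def gpRoot (n : ℕ+) :
    Algebra.GrothendieckGroup (Perfection M) ≃* Algebra.GrothendieckGroup (Perfection M) :=
  (isPerfect_gpPerfection M).rootEquiv n

/-- `(gpRoot n z)^n = z`. [cite: MochizukiFrdI2008, §0 p.11] -/
@[simp] theorem gpRoot_pow (n : ℕ+) (z : Algebra.GrothendieckGroup (Perfection M)) :
    (gpRoot M n z) ^ (n : ℕ) = z :=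
  (isPerfect_gpPerfection M).rootEquiv_pow n z

/-- `gpRoot n (z^n) = z`. [cite: MochizukiFrdI2008, §0 p.11] -/
@[simp] theorem gpRoot_apply_pow (n : ℕ+) (z : Algebra.GrothendieckGroup (Perfection M)) :
    gpRoot M n (z ^ (n : ℕ)) = z :=
  (isPerfect_gpPerfection M).rootEquiv_apply_pow n z

/-- `y = gpRoot n z ↔ y^n = z`. [cite: MochizukiFrdI2008, §0 p.11] -/
theorem eq_gpRoot_iff (n : ℕ+) {z y : Algebra.GrothendieckGroup (Perfection M)} :
    y = gpRoot M n z ↔ y ^ (n : ℕ) = z :=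
  (isPerfect_gpPerfection M).eq_rootEquiv_iff n

/-- `gpRoot (n m) = gpRoot n ∘ gpRoot m`. [cite: MochizukiFrdI2008, §0 p.11] -/
theorem gpRoot_mul (n m : ℕ+) (z : Algebra.GrothendieckGroup (Perfection M)) :
    gpRoot M (n * m) z = gpRoot M n (gpRoot M m z) :=
  (isPerfect_gpPerfection M).rootEquiv_mul n m z

/-- `gpRoot 1 = id`. [cite: MochizukiFrdI2008, §0 p.11] -/
@[simp] theorem gpRoot_one (z : Algebra.GrothendieckGroup (Perfection M)) : gpRoot M 1 z = z :=
  (isPerfect_gpPerfection M).rootEquiv_one z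

/-! ### `M^gp → (M^pf)^gp` -/

variable (M) in
/-- The natural map `M^gp → (M^pf)^gp` induced by `M → M^pf` (the arrow along which print identifies
`(Φ^gp)^pf = (Φ^pf)^gp`, Prop. 5.5 (iv)). [cite: MochizukiFrdI2008, §0 p.11] -/
noncomputable def gpToPf : Algebra.GrothendieckGroup M →* Algebra.GrothendieckGroup (Perfection M) :=
  MonGp.map (Perfection.of M)

/-- `gpToPf (of a) = of (a^{1/1})`. [cite: MochizukiFrdI2008, §0 p.11] -/
@[simp] theorem gpToPf_of (a : M) :
    gpToPf M (Algebra.GrothendieckGroup.of a) = Algebra.GrothendieckGroup.of (Perfection.of M a) :=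
  MonGp.map_of _ a

/-- **`gpRoot n (gpToPf (of a)) = of (a^{1/n})`**: the class `a^{1/n} ∈ M^pf`, viewed in `(M^pf)^gp`, is
THE `n`-th root of the image of `a`. [cite: MochizukiFrdI2008, §0 p.11] -/
theorem gpRoot_gpToPf_of (n : ℕ+) (a : M) :
    gpRoot M n (gpToPf M (Algebra.GrothendieckGroup.of a)) = Algebra.GrothendieckGroup.of (Perfection.mk a n) := by
  rw [eq_comm, eq_gpRoot_iff, ← map_pow, Perfection.mk_pow_self, gpToPf_of]

/-- More generally `gpRoot (n k) (gpToPf (of a)) = of ((a)^{1/(nk)})` and rescaling: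
`of (mk (a^k) (n k)) = of (mk a n)`. [cite: MochizukiFrdI2008, §0 p.11] -/
theorem gpOf_mk_pow_mul (a : M) (n k : ℕ+) :
    Algebra.GrothendieckGroup.of (Perfection.mk (a ^ (k : ℕ)) (n * k)) =
      Algebra.GrothendieckGroup.of (Perfection.mk a n) := by
  rw [Perfection.mk_pow_mul]

/-- Every element of `(M^pf)^gp` is an `n`-th root of an element coming from `M^gp`.
[cite: MochizukiFrdI2008, §0 p.11] -/
theorem exists_eq_gpRoot_gpToPf (z : Algebra.GrothendieckGroup (Perfection M)) :
    ∃ (n : ℕ+) (x : Algebra.GrothendieckGroup M), z = gpRoot M n (gpToPf M x) := by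
  obtain ⟨p, q, rfl⟩ := gp_exists_eq_div' z
  obtain ⟨⟨a, n⟩, rfl⟩ := Perfection.mk_surjective p
  obtain ⟨⟨b, m⟩, rfl⟩ := Perfection.mk_surjective q
  refine ⟨n * m, Algebra.GrothendieckGroup.of (a ^ (m : ℕ)) / Algebra.GrothendieckGroup.of (b ^ (n : ℕ)), ?_⟩
  dsimp only
  rw [map_div, map_div, gpRoot_gpToPf_of, gpRoot_gpToPf_of, Perfection.mk_pow_mul, mul_comm n m,
    Perfection.mk_pow_mul]

/-- Powers pass through `gpToPf` trivially; recorded form: `(gpRoot n (gpToPf x))^{n} = gpToPf x`.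
[cite: MochizukiFrdI2008, §0 p.11] -/
theorem gpRoot_gpToPf_pow (n : ℕ+) (x : Algebra.GrothendieckGroup M) :
    (gpRoot M n (gpToPf M x)) ^ (n : ℕ) = gpToPf M x :=
  gpRoot_pow n _

/-- **Kernel criterion** (cancellative `M`): `gpToPf x = gpToPf y` iff `x^N = y^N` for some `N ≥ 1` — the
map `M^gp → (M^pf)^gp` identifies exactly the elements with a common power.
[cite: MochizukiFrdI2008, §0 p.11] -/
theorem gpToPf_eq_iff [IsCancelMul M] {x y : Algebra.GrothendieckGroup M} :
    gpToPf M x = gpToPf M y ↔ ∃ N : ℕ+, x ^ (N : ℕ) = y ^ (N : ℕ) := by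
  constructor
  · intro h
    obtain ⟨a, b, rfl⟩ := gp_exists_eq_div' x
    obtain ⟨c, d, rfl⟩ := gp_exists_eq_div' y
    simp only [map_div, gpToPf_of] at h
    rw [div_eq_div_iff_mul_eq_mul, ← map_mul, ← map_mul, ← map_mul, ← map_mul, gpOf_eq_gpOf_iff] at h
    obtain ⟨e, he⟩ := h
    obtain ⟨⟨z, k⟩, rfl⟩ := Perfection.mk_surjective e
    dsimp only at he
    rw [Perfection.of_apply, Perfection.of_apply, Perfection.mk_mul_mk,
      Perfection.mk_mul_mk, PNat.one_coe, pow_one, Perfection.mk_eq_mk_iff] at he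
    obtain ⟨N, hN⟩ := he
    rw [mul_pow z, mul_pow z, ← pow_mul, ← pow_mul] at hN
    have hN' := mul_left_cancel hN
    refine ⟨k * (N * (k * 1)), ?_⟩
    have hexp : ((k * (N * (k * 1)) : ℕ+) : ℕ) = (k : ℕ) * ((N : ℕ) * ((k * 1 : ℕ+) : ℕ)) := by
      simp only [PNat.mul_coe]
    rw [hexp, div_pow, div_pow, div_eq_div_iff_mul_eq_mul, ← map_pow, ← map_pow, ← map_pow, ← map_pow,
      ← map_mul, ← map_mul, ← mul_pow, ← mul_pow, hN']
  · rintro ⟨N, hN⟩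
    apply ((isPerfect_gpPerfection M).bijective_pow N N.pos).1
    dsimp only
    rw [← map_pow, ← map_pow, hN]

end Gp

end Literature.AlgebraicGeometry.Frobenioids
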